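import Summits.AtomisticToContinuum.Crystallization.Theorems.ChargedEnergyGapBarlowResidual
import HarnessLib

/-!
(SPLIT FOR THE 400-LINE CAP by the landing lane, hand-2 g34: this file = part 1 of 2; sequels `…ChargedEnergyGapStackingClass` import it in a chain; same namespace, all FQNs unchanged.)
# Charged energy gap — lens-3 g67, node «StackingClass» (R4): the Barlow reference binder split into its two stress-free classes fcc ‖ hcp

Cell `decomp-a2c`, seat lens-3, generation 67, part P-N⁗ (over part P-N‴ `…Theorems.ChargedEnergyGapBarlowResidual`).  ELEMENTARY·PROVED
(definitions, the combinatorial classification, order lemmas, the certified translation, record cones, witnesses); 0 sorry; standard axioms.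

THE RESIDUAL OF RECORD after generation 66 (critic rows 1263, 1271) is the re-typed seam-transfer bound (H𝄪ᴮ)
`LocalSeamTransferBoundB (3/5) (1/3) 3 (1/100) (3/100) (1/2) 160 (2/5) 3 (1/3000000) 80 (1/100000)`: a far-field model-energy lower bound
demanded of every separated, labelled, force-free, SITE-STRESS-FREE, harmonically stable periodic reference WHOSE POINT SET IS A BARLOW IMAGE
`g '' barlowStacking a h s` — ANY Hägg word `s`, window `a ∈ [9/10, 11/10]`, `27a²/50 ≤ h² ≤ 121a²/150`.

THE MOVE (lens «one certified translation + split beneath»; critic row 1263 (8) «[CLS] ∧ (H𝄪ᴮ|fcc) ∧ (H𝄪ᴮ|hcp)»).  The Barlow binder and the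
site-stress binder of (H𝄪ᴮ) are jointly RIGID: a site-stress-free Barlow image in the window is an fcc-class image (constant Hägg word,
`…ABCABC…`) or an hcp-class image (alternating word, `…ABAB…`) — piece [CLS] `BarlowStressFreeClassification`.  Modulo [CLS] the residual is
EQUIVALENT to the conjunction of its two restrictions
  (H𝄪ᶠ) `LocalSeamTransferBoundFcc` := (H𝄪ᴮ) verbatim with `IsBarlowImage P.points` replaced by `IsFccImage P.points`,
  (H𝄪ʰ) `LocalSeamTransferBoundHcp` := (H𝄪ᴮ) verbatim with `IsBarlowImage P.points` replaced by `IsHcpImage P.points`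
(`localSeamTransferBoundB_iff_fcc_and_hcp`; the necessity half `LocalSeamTransferBoundB.fcc/.hcp` is unconditional), and — exactly as for the
(R1)–(R3) re-typings — the record cone needs NO classification at all: the partner reduction's proof obligations present only fcc(`a₀`) and
hcp(`a*, h*`) supercells, so the cone is re-pointed to the pair ((H𝄪ᶠ) ∧ (H𝄪ʰ), (N𝄪ᶠʰ)) with (N𝄪ᶠʰ) := (H𝄪ᶠ) → (H𝄪ʰ) → leaf, WEAKER than the
leaf and STRONGER than (N𝄪ᴮ) at NIL cost (§C4).

WHY THIS SPLIT IS NATURAL AND NOT A COSTUME (memo g67 §1–§3).  (i) Each piece is strictly smaller: (H𝄪ᶠ) drops every hcp-class and every mixed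
reference, (H𝄪ʰ) every fcc-class one; both hypothesis blocks are inhabited at the record dials (fcc: `hypothesisBlockFcc_record_inhabited`,
PROVED; hcp: the equilibrium-window obligation «STAB-k» already owed by (N𝄪ᴮ)).  (ii) The two classes have DIFFERENT second-variation mechanisms
in the periodic direction `p` of the `(p, S)`-quadratic programme that is the IDEA-NEEDED core of the residual: an fcc site has symmetry `O_h ∋ −1`,
so after the force-free / stress-free cascade the first load on the internal modes is `O(∇³ω)` (every odd-rank invariant tensor vanishes); an hcp
site has symmetry `D_3h ∌ −1` with the invariant rank-3 tensor `y(3x² − y²)`-type, so an `O(∇²ω)` internal load survives in prism-plane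
geometries (census χCOST-56: hcp(1-100) `−1.01·10⁻⁶` v fcc(001) `−1.38·10⁻⁶`, hcp(0001) = fcc(111) `−0.71·10⁻⁶` per transition site — the
basal geometry is blind to the rank-3 tensor, as the mechanism predicts).  (iii) With the reference an EXPLICIT lattice (fcc `a₀`) or an explicit
two-parameter family (hcp `(a, h)` in the window), the coercivity constants, Volterra kernels and layer sums of the residual become certified
constants of named lattices instead of suprema over an unclassified family.

CONTENTS.
* §C1 Hägg words: `IsFccHagg` (constant), `IsHcpHagg` (alternating); the second- and third-neighbour REGISTRY PROFILE `alignedPairs s j m`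
  (`j = 2, 3`: how many of the layers `m ± j` carry the letter of layer `m`) and `HasUniformRegistry`; ★★ [CLS-comb]
  `isFccHagg_or_isHcpHagg_of_uniformRegistry` — a Hägg word whose registry profile is the same at every layer is constant or alternating —
  PROVED (the mixed case `n₂ ≡ 1` forces `aligned(m) ↔ ¬aligned(m−2)`, whence `n₃(m) = [aligned(m−1)]` is not constant), with the converses.
* §C2 `IsFccImage` / `IsHcpImage` (the tree's `IsBarlowImage` with the word constraint added; both ARE Barlow images); witnesses
  `Fcc.isFccImage_fcc`, `Fcc.isFccImage_fccRef_a0` (the Lennard-Jones fcc equilibrium), `isHcpImage_hcpStacking`;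
  `hypothesisBlockFcc_record_inhabited`.
* §C3 ★ [CLS-an] `BarlowRegistryRigidity` — a site-stress-free periodic Barlow image in the window has a uniform registry profile — TYPED
  (UNDECIDED · TRUE-leaning · INSTRUMENTABLE · CERT-able; plan: the normal–normal site virial of a site in layer `m` is
  `τ₀(a,h) + Σ_{j≥2} n_j(m)·δ_j(a,h)` with `δ_j` = aligned-minus-offset layer sum at height `jh` [VIR], and on the window
  `|δ₂| > 2Σ_{j≥3}|δ_j|`, `|δ₃| > 2Σ_{j≥4}|δ_j|` [DOM] — Poisson-side numerics g67 `num/delta_layers.out`: `δ₂^⊥ ∈ [1.5·10⁻⁴, 2.9·10⁻³]`,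
  `δ₃^⊥ ∈ [1.2·10⁻⁷, 1.7·10⁻⁵]`, dominance margins `≥ 98 %` on an `11 × 11` grid; at the hcp point it reproduces the tree's dhcp residual
  `(−3.35·10⁻⁴, +9.6·10⁻⁴)` of `…RotationTest` §M1); ★ [CLS] `BarlowStressFreeClassification` and the glue `[CLS-an] ⟹ [CLS]` (through
  [CLS-comb], PROVED); the bridge `IsSiteStressFree.siteVirial_eq_zero` (motif ⟹ all sites).
* §C4 ★ (H𝄪ᶠ) `LocalSeamTransferBoundFcc`, (H𝄪ʰ) `LocalSeamTransferBoundHcp`, necessity from (H𝄪ᴮ), ★★ THE CERTIFIED TRANSLATION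
  `localSeamTransferBoundB_of_fcc_of_hcp` ([CLS] → (H𝄪ᶠ) → (H𝄪ʰ) → (H𝄪ᴮ), `C_H := max`) and `localSeamTransferBoundB_iff_fcc_and_hcp`;
  (N𝄪ᶠʰ) `LocalSeamReductionFH` with its order lemmas (⟸ leaf; ⟹ (N𝄪ᴮ); ⟸ (N𝄪ᴮ) under [CLS]).
* §C5 ★★ record cones: `chargedEnergyGap_of_localLedgerFH` (any `ϱ`, any weight system) and `chargedEnergyGap_of_maxCoverLocalLedgerFH_record`
  (`ϱ = 160`; THE RECORD-DESIGNATE OF GENERATION 67: eleven leaves, the two transfer pieces and the re-typed reduction replacing (H𝄪ᴮ)/(N𝄪ᴮ));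
  the classification variant `chargedEnergyGap_of_maxCoverLocalLedgerCls_record` ([CLS] + (H𝄪ᶠ) + (H𝄪ʰ) + (N𝄪ᴮ)); consistency with (R3).
* §C6 the typed certificate beneath [CLS-an]: the normal–normal LAYER SUMS `layerSumNN a h j t`, the registry contrasts `layerDeltaNN` (`δ_j^⊥`),
  ★ [DOM] `LayerDominance` (the interval-arithmetic target) and ★ [VIR-red] `RegistryRigidityOfDominance` ([DOM] ⟹ [CLS-an], the layer-sum
  identity); glue `barlowStressFreeClassification_of_dominance`; `layerSumNN_neg_one` (the two shifted classes agree).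
-/

noncomputable section

open scoped Classical
open Literature.MathematicalPhysics.StatisticalMechanics Literature.Geometry.DiscreteGeometry
open Summit.AtomisticToContinuum.Crystallization.Theses.PricedLinkCensus
open Summit.AtomisticToContinuum.Crystallization.Theorems.ChargedEnergyGapNegative

namespace Summit.AtomisticToContinuum.Crystallization.Theorems.ChargedEnergyGapChartDial

/-! ## §C1 Hägg words: the fcc and hcp classes, the registry profile, the combinatorial classification [CLS-comb] -/

section Words

variable {s : ℤ → ℤ}

/-- **fcc-CLASS HÄGG WORD**: constant (`+1` everywhere, `…ABCABC…`, or `−1` everywhere, its mirror image `…ACBACB…`). -/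
def IsFccHagg (s : ℤ → ℤ) : Prop := ∀ i : ℤ, s (i + 1) = s i

/-- **hcp-CLASS HÄGG WORD**: alternating (`…ABAB…`, either phase). -/
def IsHcpHagg (s : ℤ → ℤ) : Prop := ∀ i : ℤ, s (i + 1) = -s i

/-- The constant word is fcc-class. -/
theorem isFccHagg_constHagg : IsFccHagg constHagg := fun _ => rfl

/-- The alternating word is hcp-class. -/
theorem isHcpHagg_alternatingHagg : IsHcpHagg alternatingHagg := fun i => by
  by_cases h : Even i <;> simp [alternatingHagg, h]

/-- A word is not both (a Hägg word has no zero). -/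
theorem not_isFccHagg_and_isHcpHagg (hs : IsHaggSeq s) : ¬ (IsFccHagg s ∧ IsHcpHagg s) := by
  rintro ⟨hf, hh⟩
  have h1 := hf 0
  have h2 := hh 0
  rcases hs 0 with h0 | h0 <;> omega

/-- The length-two window. [formal bookkeeping] -/
theorem haggWindow_two (s : ℤ → ℤ) (m : ℤ) : haggWindow s m 2 = s m + s (m + 1) := by
  simp [haggWindow, Finset.sum_range_succ]

/-- The length-three window. [formal bookkeeping] -/
theorem haggWindow_three (s : ℤ → ℤ) (m : ℤ) : haggWindow s m 3 = s m + s (m + 1) + s (m + 2) := by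
  simp [haggWindow, Finset.sum_range_succ]

/-- SECOND NEIGHBOURS: layers `m`, `m + 2` of a Hägg stacking carry the same letter iff the word turns round between them.
(`private`: file-local twin of the landed `…LayeredHull.clo_haggAligned_two_iff` — gate dedup rule; landing lane hand-2 g34.) -/
private theorem haggAligned_two_iff (hs : IsHaggSeq s) (m : ℤ) : HaggAligned s m 2 ↔ s (m + 1) = -s m := by
  rw [haggAligned_iff, ← haggWindow_eq, haggWindow_two]
  rcases hs m with h0 | h0 <;> rcases hs (m + 1) with h1 | h1 <;> rw [h0, h1] <;> omega

/-- … and carry different letters iff the word runs on. -/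
theorem not_haggAligned_two_iff (hs : IsHaggSeq s) (m : ℤ) : ¬ HaggAligned s m 2 ↔ s (m + 1) = s m := by
  rw [haggAligned_two_iff hs]
  rcases hs m with h0 | h0 <;> rcases hs (m + 1) with h1 | h1 <;> rw [h0, h1] <;> omega

/-- THIRD NEIGHBOURS: layers `m`, `m + 3` carry the same letter iff the word is constant on `{m, m+1, m+2}`. -/
theorem haggAligned_three_iff (hs : IsHaggSeq s) (m : ℤ) : HaggAligned s m 3 ↔ s (m + 1) = s m ∧ s (m + 2) = s m := by
  rw [haggAligned_iff, ← haggWindow_eq, haggWindow_three]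
  rcases hs m with h0 | h0 <;> rcases hs (m + 1) with h1 | h1 <;> rcases hs (m + 2) with h2 | h2 <;> rw [h0, h1, h2] <;> omega

/-- Third-neighbour alignment in terms of second-neighbour alignment: `aligned₃(m) ↔ ¬aligned₂(m) ∧ ¬aligned₂(m+1)`. -/
theorem haggAligned_three_iff_two (hs : IsHaggSeq s) (m : ℤ) :
    HaggAligned s m 3 ↔ ¬ HaggAligned s m 2 ∧ ¬ HaggAligned s (m + 1) 2 := by
  rw [haggAligned_three_iff hs, not_haggAligned_two_iff hs, not_haggAligned_two_iff hs, add_assoc,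
    show (1 : ℤ) + 1 = 2 by norm_num]
  constructor
  · rintro ⟨h1, h2⟩
    exact ⟨h1, by rw [h2, h1]⟩
  · rintro ⟨h1, h2⟩
    exact ⟨h1, by rw [h2, h1]⟩

/-- The same at the level of indicators (for rewriting inside the registry profile). [formal bookkeeping] -/
theorem ite_haggAligned_three (hs : IsHaggSeq s) (m : ℤ) :
    (if HaggAligned s m 3 then (1 : ℕ) else 0) = if ¬ HaggAligned s m 2 ∧ ¬ HaggAligned s (m + 1) 2 then 1 else 0 :=
  if_congr (haggAligned_three_iff_two hs m) rfl rfl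

/-- **THE REGISTRY PROFILE** of layer `m` at range `j`: how many of the two layers `m + j`, `m − j` carry the letter of layer `m` (`0`, `1` or `2`).
For a close-packed stacking this is the number of `j`-th neighbour LAYERS in vertical registry with layer `m`; `j = 1` is always `0`. -/
def alignedPairs (s : ℤ → ℤ) (j : ℕ) (m : ℤ) : ℕ :=
  (if HaggAligned s m j then 1 else 0) + (if HaggAligned s (m - j) j then 1 else 0)

/-- **UNIFORM REGISTRY**: the second- and third-neighbour registry profile is the same at every layer. -/
def HasUniformRegistry (s : ℤ → ℤ) : Prop :=
  (∀ m : ℤ, alignedPairs s 2 m = alignedPairs s 2 0) ∧ ∀ m : ℤ, alignedPairs s 3 m = alignedPairs s 3 0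

/-- Unfolding at range two. [formal bookkeeping] -/
theorem alignedPairs_two (s : ℤ → ℤ) (m : ℤ) :
    alignedPairs s 2 m = (if HaggAligned s m 2 then 1 else 0) + (if HaggAligned s (m - 2) 2 then 1 else 0) := rfl

/-- Unfolding at range three. [formal bookkeeping] -/
theorem alignedPairs_three (s : ℤ → ℤ) (m : ℤ) :
    alignedPairs s 3 m = (if HaggAligned s m 3 then 1 else 0) + (if HaggAligned s (m - 3) 3 then 1 else 0) := rfl

/-- Indicator bookkeeping: a two-indicator sum is `2` iff both hold … [formal bookkeeping] -/
theorem and_of_ite_add_ite_eq_two {p q : Prop} [Decidable p] [Decidable q]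
    (h : (if p then 1 else 0) + (if q then 1 else 0) = (2 : ℕ)) : p ∧ q := by
  by_cases hp : p <;> by_cases hq : q <;> simp [hp, hq] at h ⊢

/-- … `0` iff neither holds … [formal bookkeeping] -/
theorem not_and_not_of_ite_add_ite_eq_zero {p q : Prop} [Decidable p] [Decidable q]
    (h : (if p then 1 else 0) + (if q then 1 else 0) = (0 : ℕ)) : ¬ p ∧ ¬ q := by
  by_cases hp : p <;> by_cases hq : q <;> simp [hp, hq] at h ⊢

/-- … `1` iff exactly one holds. [formal bookkeeping] -/
theorem iff_not_of_ite_add_ite_eq_one {p q : Prop} [Decidable p] [Decidable q]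
    (h : (if p then 1 else 0) + (if q then 1 else 0) = (1 : ℕ)) : (p ↔ ¬ q) := by
  by_cases hp : p <;> by_cases hq : q <;> simp [hp, hq] at h ⊢

/-- ★ THE MIXED CASE IS NOT UNIFORM: if exactly one of the two second-neighbour layers of EVERY layer is in registry, the third-neighbour count
is not constant.  (From `aligned₂(m) ↔ ¬aligned₂(m − 2)` one gets `n₃(1) = [aligned₂ 0]` and `n₃(3) = [¬aligned₂ 0]`.) -/
theorem false_of_alignedPairs_two_eq_one (hs : IsHaggSeq s)
    (h2 : ∀ m : ℤ, (if HaggAligned s m 2 then 1 else 0) + (if HaggAligned s (m - 2) 2 then 1 else 0) = (1 : ℕ))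
    (h3 : ∀ m : ℤ, alignedPairs s 3 m = alignedPairs s 3 0) : False := by
  have xor : ∀ m : ℤ, (HaggAligned s m 2 ↔ ¬ HaggAligned s (m - 2) 2) := fun m => iff_not_of_ite_add_ite_eq_one (h2 m)
  -- the five instances used: `P0 ↔ ¬P(-2)`, `P1 ↔ ¬P(-1)`, `P2 ↔ ¬P0`, `P3 ↔ ¬P1`, `P4 ↔ ¬P2`
  have x0 := xor 0
  have x1 := xor 1
  have x2 := xor 2
  have x3 := xor 3
  have x4 := xor 4
  rw [show (0 : ℤ) - 2 = -2 by norm_num] at x0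
  rw [show (1 : ℤ) - 2 = -1 by norm_num] at x1
  rw [show (2 : ℤ) - 2 = 0 by norm_num] at x2
  rw [show (3 : ℤ) - 2 = 1 by norm_num] at x3
  rw [show (4 : ℤ) - 2 = 2 by norm_num] at x4
  -- `n₃(1) = n₃(3)` written out in second-neighbour alignments
  have e : alignedPairs s 3 1 = alignedPairs s 3 3 := by rw [h3 1, h3 3]
  rw [alignedPairs_three, alignedPairs_three, show (1 : ℤ) - 3 = -2 by norm_num, show (3 : ℤ) - 3 = 0 by norm_num,
    ite_haggAligned_three hs 1, ite_haggAligned_three hs (-2), ite_haggAligned_three hs 3, ite_haggAligned_three hs 0,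
    show (1 : ℤ) + 1 = 2 by norm_num, show (-2 : ℤ) + 1 = -1 by norm_num, show (3 : ℤ) + 1 = 4 by norm_num,
    show (0 : ℤ) + 1 = 1 by norm_num] at e
  -- e : [¬P1 ∧ ¬P2] + [¬P(-2) ∧ ¬P(-1)] = [¬P3 ∧ ¬P4] + [¬P0 ∧ ¬P1]; four cases on (P0, P1)
  by_cases h0 : HaggAligned s 0 2 <;> by_cases h1 : HaggAligned s 1 2
  · have hP2 : ¬ HaggAligned s 2 2 := fun h => x2.1 h h0
    have c1 : ¬ (¬ HaggAligned s 1 2 ∧ ¬ HaggAligned s 2 2) := fun h => h.1 h1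
    have c2 : ¬ HaggAligned s (-2) 2 ∧ ¬ HaggAligned s (-1) 2 := ⟨x0.1 h0, x1.1 h1⟩
    have c3 : ¬ (¬ HaggAligned s 3 2 ∧ ¬ HaggAligned s 4 2) := fun h => h.2 (x4.2 hP2)
    have c4 : ¬ (¬ HaggAligned s 0 2 ∧ ¬ HaggAligned s 1 2) := fun h => h.1 h0
    rw [if_neg c1, if_pos c2, if_neg c3, if_neg c4] at e
    exact absurd e (by norm_num)
  · have hP2 : ¬ HaggAligned s 2 2 := fun h => x2.1 h h0
    have hPm1 : HaggAligned s (-1) 2 := not_not.1 fun h => h1 (x1.2 h)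
    have c1 : ¬ HaggAligned s 1 2 ∧ ¬ HaggAligned s 2 2 := ⟨h1, hP2⟩
    have c2 : ¬ (¬ HaggAligned s (-2) 2 ∧ ¬ HaggAligned s (-1) 2) := fun h => h.2 hPm1
    have c3 : ¬ (¬ HaggAligned s 3 2 ∧ ¬ HaggAligned s 4 2) := fun h => h.1 (x3.2 h1)
    have c4 : ¬ (¬ HaggAligned s 0 2 ∧ ¬ HaggAligned s 1 2) := fun h => h.1 h0
    rw [if_pos c1, if_neg c2, if_neg c3, if_neg c4] at e
    exact absurd e (by norm_num)
  · have hP2 : HaggAligned s 2 2 := x2.2 h0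
    have hPm2 : HaggAligned s (-2) 2 := not_not.1 fun h => h0 (x0.2 h)
    have c1 : ¬ (¬ HaggAligned s 1 2 ∧ ¬ HaggAligned s 2 2) := fun h => h.1 h1
    have c2 : ¬ (¬ HaggAligned s (-2) 2 ∧ ¬ HaggAligned s (-1) 2) := fun h => h.1 hPm2
    have c3 : ¬ HaggAligned s 3 2 ∧ ¬ HaggAligned s 4 2 := ⟨fun h => x3.1 h h1, fun h => x4.1 h hP2⟩
    have c4 : ¬ (¬ HaggAligned s 0 2 ∧ ¬ HaggAligned s 1 2) := fun h => h.2 h1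
    rw [if_neg c1, if_neg c2, if_pos c3, if_neg c4] at e
    exact absurd e (by norm_num)
  · have hP2 : HaggAligned s 2 2 := x2.2 h0
    have hPm2 : HaggAligned s (-2) 2 := not_not.1 fun h => h0 (x0.2 h)
    have c1 : ¬ (¬ HaggAligned s 1 2 ∧ ¬ HaggAligned s 2 2) := fun h => h.2 hP2
    have c2 : ¬ (¬ HaggAligned s (-2) 2 ∧ ¬ HaggAligned s (-1) 2) := fun h => h.1 hPm2
    have c3 : ¬ (¬ HaggAligned s 3 2 ∧ ¬ HaggAligned s 4 2) := fun h => h.1 (x3.2 h1)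
    have c4 : ¬ HaggAligned s 0 2 ∧ ¬ HaggAligned s 1 2 := ⟨h0, h1⟩
    rw [if_neg c1, if_neg c2, if_neg c3, if_pos c4] at e
    exact absurd e (by norm_num)

/-- ★★ piece [CLS-comb] · PROVED · **THE COMBINATORIAL CLASSIFICATION**: a Hägg word whose second- and third-neighbour registry profile is the
same at every layer is CONSTANT (fcc class) or ALTERNATING (hcp class).  Proof: `n₂ ≡ 0` ⟹ the word never turns (fcc); `n₂ ≡ 2` ⟹ it turns at
every layer (hcp); `n₂ ≡ 1` is impossible with `n₃` constant (`false_of_alignedPairs_two_eq_one`). -/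
theorem isFccHagg_or_isHcpHagg_of_uniformRegistry (hs : IsHaggSeq s) (hu : HasUniformRegistry s) : IsFccHagg s ∨ IsHcpHagg s := by
  obtain ⟨h2, h3⟩ := hu
  by_cases hA : HaggAligned s 0 2 <;> by_cases hB : HaggAligned s (0 - 2) 2
  · -- `n₂ ≡ 2`: hcp class
    refine Or.inr fun m => (haggAligned_two_iff hs m).1 ?_
    have hm := h2 m
    rw [alignedPairs_two, alignedPairs_two, if_pos hA, if_pos hB] at hm
    exact (and_of_ite_add_ite_eq_two hm).1
  · exact (false_of_alignedPairs_two_eq_one hs (fun m => by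
      have hm := h2 m
      rwa [alignedPairs_two, alignedPairs_two, if_pos hA, if_neg hB] at hm) h3).elim
  · exact (false_of_alignedPairs_two_eq_one hs (fun m => by
      have hm := h2 m
      rwa [alignedPairs_two, alignedPairs_two, if_neg hA, if_pos hB] at hm) h3).elim
  · -- `n₂ ≡ 0`: fcc class
    refine Or.inl fun m => (not_haggAligned_two_iff hs m).1 ?_
    have hm := h2 m
    rw [alignedPairs_two, alignedPairs_two, if_neg hA, if_neg hB] at hm
    exact (not_and_not_of_ite_add_ite_eq_zero hm).1

/-- Converse (sharpness): the fcc-class words HAVE a uniform registry (`n₂ ≡ 0`, `n₃ ≡ 2`) … -/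
theorem hasUniformRegistry_of_isFccHagg (hs : IsHaggSeq s) (h : IsFccHagg s) : HasUniformRegistry s := by
  have hP : ∀ m : ℤ, ¬ HaggAligned s m 2 := fun m => (not_haggAligned_two_iff hs m).2 (h m)
  have hA : ∀ m : ℤ, HaggAligned s m 3 := fun m => (haggAligned_three_iff_two hs m).2 ⟨hP m, hP (m + 1)⟩
  exact ⟨fun m => by rw [alignedPairs_two, alignedPairs_two, if_neg (hP m), if_neg (hP (m - 2)), if_neg (hP 0), if_neg (hP (0 - 2))],
    fun m => by rw [alignedPairs_three, alignedPairs_three, if_pos (hA m), if_pos (hA (m - 3)), if_pos (hA 0), if_pos (hA (0 - 3))]⟩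

/-- … and so do the hcp-class words (`n₂ ≡ 2`, `n₃ ≡ 0`): the classification [CLS-comb] is an equivalence. -/
theorem hasUniformRegistry_of_isHcpHagg (hs : IsHaggSeq s) (h : IsHcpHagg s) : HasUniformRegistry s := by
  have hP : ∀ m : ℤ, HaggAligned s m 2 := fun m => (haggAligned_two_iff hs m).2 (h m)
  have hA : ∀ m : ℤ, ¬ HaggAligned s m 3 := fun m h3 => ((haggAligned_three_iff_two hs m).1 h3).1 (hP m)
  exact ⟨fun m => by rw [alignedPairs_two, alignedPairs_two, if_pos (hP m), if_pos (hP (m - 2)), if_pos (hP 0), if_pos (hP (0 - 2))],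
    fun m => by rw [alignedPairs_three, alignedPairs_three, if_neg (hA m), if_neg (hA (m - 3)), if_neg (hA 0), if_neg (hA (0 - 3))]⟩

/-- [CLS-comb] as an `iff`. -/
theorem hasUniformRegistry_iff (hs : IsHaggSeq s) : HasUniformRegistry s ↔ IsFccHagg s ∨ IsHcpHagg s :=
  ⟨isFccHagg_or_isHcpHagg_of_uniformRegistry hs, fun h => h.elim (hasUniformRegistry_of_isFccHagg hs) (hasUniformRegistry_of_isHcpHagg hs)⟩

end Words

/-! ## §C2 fcc-class and hcp-class Barlow images; witnesses -/

section Images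

/-- **fcc-CLASS BARLOW IMAGE**: the tree's `IsBarlowImage` (window included) with a CONSTANT Hägg word — a rigid copy of an fcc lattice with
nearest-neighbour spacing `a ∈ [9/10, 11/10]` along the layers and layer spacing `h`, `27a²/50 ≤ h² ≤ 121a²/150` (a rhombohedrally strained fcc
unless `h² = 2a²/3`). -/
def IsFccImage (S : Set E3) : Prop :=
  ∃ (a h : ℝ) (s : ℤ → ℤ) (g : E3 → E3),
    (9 / 10 ≤ a ∧ a ≤ 11 / 10) ∧ (0 < h ∧ 27 / 50 * a ^ 2 ≤ h ^ 2 ∧ h ^ 2 ≤ 121 / 150 * a ^ 2) ∧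
      IsHaggSeq s ∧ IsFccHagg s ∧ Isometry g ∧ S = g '' barlowStacking a h s

/-- **hcp-CLASS BARLOW IMAGE**: the same with an ALTERNATING Hägg word — a rigid copy of `hcpStacking a h` (up to the phase of the word). -/
def IsHcpImage (S : Set E3) : Prop :=
  ∃ (a h : ℝ) (s : ℤ → ℤ) (g : E3 → E3),
    (9 / 10 ≤ a ∧ a ≤ 11 / 10) ∧ (0 < h ∧ 27 / 50 * a ^ 2 ≤ h ^ 2 ∧ h ^ 2 ≤ 121 / 150 * a ^ 2) ∧
      IsHaggSeq s ∧ IsHcpHagg s ∧ Isometry g ∧ S = g '' barlowStacking a h s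

variable {S : Set E3}

/-- An fcc-class image is a Barlow image. -/
theorem IsFccImage.isBarlowImage (h : IsFccImage S) : IsBarlowImage S := by
  obtain ⟨a, hh, s, g, ha, hh', hs, _, hg, hS⟩ := h
  exact ⟨a, hh, s, g, ha, hh', hs, hg, hS⟩

/-- An hcp-class image is a Barlow image. -/
theorem IsHcpImage.isBarlowImage (h : IsHcpImage S) : IsBarlowImage S := by
  obtain ⟨a, hh, s, g, ha, hh', hs, _, hg, hS⟩ := h
  exact ⟨a, hh, s, g, ha, hh', hs, hg, hS⟩

/-- Every admissible hcp stacking is an hcp-class image (identity motion). -/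
theorem isHcpImage_hcpStacking {a h : ℝ} (ha : 9 / 10 ≤ a ∧ a ≤ 11 / 10)
    (hh : 0 < h ∧ 27 / 50 * a ^ 2 ≤ h ^ 2 ∧ h ^ 2 ≤ 121 / 150 * a ^ 2) : IsHcpImage (hcpStacking a h) :=
  ⟨a, h, alternatingHagg, id, ha, hh, isHaggSeq_alternating, isHcpHagg_alternatingHagg, isometry_id, (Set.image_id _).symm⟩

/-- Every admissible fcc stacking is an fcc-class image (identity motion). -/
theorem isFccImage_fccStacking {a h : ℝ} (ha : 9 / 10 ≤ a ∧ a ≤ 11 / 10)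
    (hh : 0 < h ∧ 27 / 50 * a ^ 2 ≤ h ^ 2 ∧ h ^ 2 ≤ 121 / 150 * a ^ 2) : IsFccImage (fccStacking a h) :=
  ⟨a, h, constHagg, id, ha, hh, isHaggSeq_const, isFccHagg_constHagg, isometry_id, (Set.image_id _).symm⟩

namespace Fcc

/-- ★ The fcc configuration `b·D₃` at nearest-neighbour spacing `a ∈ [9/10, 11/10]` is an fcc-CLASS image (the datum of `isBarlowImage_fcc`:
constant word, the rotation `rot`). -/
theorem isFccImage_fcc {a : ℝ} (ha : 9 / 10 ≤ a ∧ a ≤ 11 / 10) :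
    IsFccImage (fccRef (bOf a) (bOf_pos (by linarith [ha.1]))).points :=
  ⟨a, hOf a, constHagg, rot, ha, ⟨hOf_pos (by linarith [ha.1]), by rw [hOf_sq]; nlinarith, by rw [hOf_sq]; nlinarith⟩,
    isHaggSeq_const, isFccHagg_constHagg, isometry_rot, (image_rot_fcc a (by linarith [ha.1])).symm⟩

/-- ★★ The Lennard-Jones fcc equilibrium `fccRef a₀` IS AN fcc-CLASS IMAGE (window `9/10 ≤ a₀√2 ≤ 11/10`, §R5 of part P-N‴). -/
theorem isFccImage_fccRef_a0 : IsFccImage (fccRef a0 a0_pos).points := by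
  have h := isFccImage_fcc a0_sqrt2_window
  rwa [fccRef_points_congr (bOf_pos (by linarith [nine_tenths_le_a0_sqrt2])) a0_pos (bOf_self_mul_sqrt2 a0)] at h

end Fcc

/-- ★★ The admissibility block of (H𝄪ᶠ) at the record dials — `IsSeparatedRef (3/5) ∧ IsLabelledRef (1/3) 3 ∧ IsFccImage ·.points ∧ IsForceFree ∧
IsSiteStressFree ∧ HarmStableModRot (1/100)` — is inhabited (by `fccRef a₀`): the fcc piece is not vacuous by an empty hypothesis block, and the
hcp piece (H𝄪ʰ) is STRICTLY weaker than (H𝄪ᴮ) (it drops an inhabited class). -/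
theorem hypothesisBlockFcc_record_inhabited : ∃ P : PeriodicConfiguration 3,
    IsSeparatedRef (3 / 5) P ∧ IsLabelledRef (1 / 3) 3 P ∧ IsFccImage P.points ∧ IsForceFree P ∧ IsSiteStressFree P ∧
      HarmStableModRot (1 / 100) P :=
  ⟨Fcc.fccRef Fcc.a0 Fcc.a0_pos, Fcc.fcc_witness.1, Fcc.fcc_witness.2.1, Fcc.isFccImage_fccRef_a0, Fcc.fcc_witness.2.2.1,
    Fcc.isSiteStressFree_fcc, Fcc.harmStableModRot_fcc_a0_record⟩

end Images

end Summit.AtomisticToContinuum.Crystallization.Theorems.ChargedEnergyGapChartDial
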